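/-
Copyright (c) 2026. All rights reserved.
Released under Apache 2.0 license as described in the file LICENSE.
Authors: abc-iut cell, statement-typer seat abc-iut-L4-t9 (wave 2, block W2-B2).
-/
import Mathlib.CategoryTheory.Limits.Shapes.Pullback.Categorical.Basic
import Mathlib.Combinatorics.Quiver.Prefunctor
import HarnessLib

/-!
# [AbsTopIII] Corollary 3.7: MLF-Galois-theoretic bi-anabelian log-Frobenius incompatibility —
# the setting, the categorical fibre product `𝒳 ×_𝔈 𝒳`, and the diagonal telecore datum

S. Mochizuki, *Topics in absolute anabelian geometry III: global reconstruction algorithms*,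
J. Math. Sci. Univ. Tokyo 22 (2015) 939–1156 [MochizukiAbsTopIII2015]. Locators `p.N` are the pages
of the author's manuscript (`paper:url-5493eb38cbb7`, 164 pp.; the journal pagination is not held),
read on the page: Cor 3.7 pp. 86–88, Rmk 3.7.1 pp. 88–89, Rmk 3.7.2 pp. 89–90, Rmk 3.7.3 pp. 90–93,
Rmk 3.7.4 pp. 93–94; the categorical fibre product is §0 'Categories' p. 28; nexus §0 p. 27;
Def 3.1 (iii)/(iv) pp. 67–69 (the categories `𝒳, 𝔈, 𝒩`, the functors `log, λ^×, λ^{×pf}`, the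
natural transformations `ι_log, ι_×`); Cor 3.6 pp. 78–80 (the diagram `𝒟` whose rows 2–4 `𝒟†`
re-uses).

## What Corollary 3.7 says (p. 86)

"In the notation and conventions of Corollary 3.6, suppose, further, that `T = T𝔽`. Consider the
diagram of categories `𝒟†`
`… 𝒳 ×_𝔈 𝒳 —log_𝒳→ 𝒳 ×_𝔈 𝒳 —log_𝒳→ 𝒳 ×_𝔈 𝒳 …` (row 1, vertices `⋎ ∈ L`, projections
`pr_⋎` to) `𝒳` (row 2, the vertex `□`) `⇉^{λ^×}_{λ^{×pf}} 𝒩 → 𝔈` — where the second to fourth rows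
of `𝒟†` are identical to the second to fourth rows of the diagram `𝒟` of Corollary 3.6; `𝒟†_{≤1}`
is obtained by applying the categorical fiber product `(−) ×_𝔈 𝒳` to `𝒟_{≤1}`; `pr_⋎` denotes the
projection to the first factor [...]; `π_⋎ : 𝒳 ×_𝔈 𝒳 → 𝒳` the projection to the second factor
[...], `𝒟‡` the result of appending these arrows `π_⋎` to `𝒟†` — where we think of the codomain
`𝒳` of the arrows `π_⋎` as a new core vertex [...]". Items (i)–(v) then assert core / telecore /
contact / observable structures on these diagrams, two incompatibilities, and the nexus /
rigidity / `ℤ`-symmetry statement (quoted at the declarations below and in the sibling file).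

## How it is typed (θ-ruling of plan/L4/ASSIGNMENTS.md §2: no closed `∃` over data that cannot
## pin its target; abstract categorical data in, constructions and per-datum `Prop`s out)

* INPUT = `BiAnabelianSetting`: rows ≤ 4 of the diagram `𝒟` of Cor 3.6 with `T = T𝔽`, as
  ABSTRACT categories and functors (`𝒳 = 𝒞^{MLF-sB}_{T𝔽}`, `𝔈 = 𝒯𝔾_{sB}`, `𝒩 = 𝒞^{MLF-sB}_{T𝕊}`;
  `gal : 𝒳 ⥤ 𝔈` = "`(Π ↷ M) ↦ Π`" of Def 3.1 (iii); `log` with `log ≅ 𝟭` = Def 3.1 (iv) "the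
  functor `log_{T𝔽,T𝔽}` is isomorphic to the identity functor" — elementary for `T = T𝔽`, which is
  exactly why Cor 3.7 assumes `T = T𝔽` (Rmk 3.7.1); `λ^×, λ^{×pf}, ι_log, ι_×`; `𝒩 → 𝔈`). The
  genuine instance needs the étale `π₁` of hyperbolic orbicurves of strictly Belyi type over MLFs
  (plan/FOUNDATIONS.md row 12: absent, a later FACT-row construction), so nothing here is
  instantiated; the mono-anabelian rows 5–6 of `𝒟` (`Anab`, `κ_An`, `φ_An`, `η_An`) do NOT occur
  in Cor 3.7 and are deliberately absent.
  -- TODO-merge abc-iut-L4-t2 / abc-iut-L4-t5: `BiAnabelianSetting` is the restriction of the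
  -- Cor 3.6 input structure `LogFrobeniusData` (LogFrobeniusDiagram.lean, in-seat at t2, not yet
  -- filed/staged 2026-08-25T19:00Z); when it lands, add `def BiAnabelianSetting.ofLogFrobeniusData`.
* `𝒳 ×_𝔈 𝒳` is NOT re-defined: [AbsTopIII] §0 p. 28 "the categorical fiber product `𝒞₁ ×_𝒟 𝒞₂`
  [...] whose objects are triples `(A₁, A₂, α : Φ₁(A₁) ⥲ Φ₂(A₂))` [...] and whose morphisms [...]
  are pairs of morphisms `γ_i : A_i → B_i` such that `β ∘ Φ₁(γ₁) = Φ₂(γ₂) ∘ α`" is VERBATIM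
  Mathlib's `CategoryTheory.Limits.CategoricalPullback Φ₁ Φ₂` (fields `fst, snd, iso`; morphisms
  `Hom.fst, Hom.snd, Hom.w`); `pr_⋎ = CategoricalPullback.π₁`, `π_⋎ = CategoricalPullback.π₂`.
* PROVED (real category theory, any functor `Φ : 𝒳 ⥤ 𝔈`): the diagonal functor `δ_𝒳`
  (`FiberSquare.diagonal`), `δ_𝒳 ⋙ π = 𝟭` on the nose, the base change `log ×_𝔈 𝒳`
  (`FiberSquare.baseChange`) and its strict compatibilities with `pr`/`π`; and the first two
  sentences of Cor 3.7 (ii): from the bi-anabelian datum `θ^bi : pr^bi_1 ⥲ pr^bi_2` lying over the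
  structure isomorphisms ("arises from the functoriality — i.e., the bi-anabelian [or 'Grothendieck
  Conjecture'-type] portion — of the 'group-theoretic' algorithms of Corollary 1.10", entering as
  the hypothesis structure `BiAnabelianLift`), `δ_𝒳` IS an equivalence of categories with
  quasi-inverse `π_𝒳`, and `θ^bi` determines `θ_𝒳 : δ_𝒳 ∘ π_𝒳 ⥲ id` (`BiAnabelianLift.thetaX`,
  `BiAnabelianLift.diagonalEquivalence`).
* The ORIENTED GRAPHS underlying `𝒟† ⊆ 𝒟‡ ⊆ 𝒟*`, the nexus `□` and the `ℤ`-translation (the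
  graph half of Cor 3.7 (v)), and the records of Remarks 3.7.1–3.7.4 are in the companion file
  `MonoAnabelianComparisonShapes.lean`.
* NOT HERE (sibling file `BiAnabelianIncompatibility.lean`, typed over abc-iut-L4-t2's Def 3.5
  formalism `DiagramOfCategories` / `Observable.IsCore` / `Telecore` / `IsContactStructure`
  (p404096) once it is built): the diagram-of-categories statements Cor 3.7 (i), (ii) [telecore
  `𝔗_δ`, family of homotopies `ℋ_δ`], (iii) [observable `𝔖†_log`], (iv) [the two
  incompatibilities], (v) [total `□`-rigidity, `ℤ` acting by nexus-classes of self-equivalences].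
  The functor-level 2-cells those structures are generated by are constructed here
  (`FiberSquare.*`, `BiAnabelianSetting.*`), as is the natural-transformation identity that a
  core structure compatible with `𝔖†_log` would force (`BiAnabelianSetting.LogCoreKernel`, read
  off the proof of Cor 3.6 (iv) p. 81, which Cor 3.7's proof p. 88 declares "entirely similar").

Refereed pre-IUT anabelian geometry; nothing in this file bears on [IUTchIII] Cor. 3.12, and
"typed" here is not "discharged" except where a `theorem`/construction says so.
-/

set_option autoImplicit false

namespace Literature.AnabelianGeometry.AbsoluteAnabelian.AbsTopIII

open CategoryTheory CategoryTheory.Limits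

universe v₁ v₂ v₃ u₁ u₂ u₃

/-! ## The categorical fibre product `𝒳 ×_𝔈 𝒳`, its diagonal, and base change along `𝔈`-functors -/

namespace FiberSquare

variable {X : Type u₁} [Category.{v₁} X] {E : Type u₂} [Category.{v₂} E] (Φ : X ⥤ E)

/-- The *diagonal functor* `δ_𝒳 : 𝒳 → 𝒳 ×_𝔈 𝒳`, `A ↦ (A, A, id : Φ(A) ⥲ Φ(A))`, into the
categorical fibre product of [AbsTopIII] §0 p. 28 (= Mathlib's `CategoricalPullback Φ Φ`).
[cite: MochizukiAbsTopIII2015, Cor 3.7 (ii) p.87] -/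
@[simps]
def diagonal : X ⥤ CategoricalPullback Φ Φ where
  obj A := ⟨A, A, Iso.refl _⟩
  map f := ⟨f, f, by simp⟩

/-- `δ_𝒳` followed by the projection to the second factor `π_𝒳` is the identity functor, on the
nose. [cite: MochizukiAbsTopIII2015, Cor 3.7 (ii) p.87] -/
theorem diagonal_comp_π₂ : diagonal Φ ⋙ CategoricalPullback.π₂ Φ Φ = 𝟭 X := rfl

/-- `δ_𝒳` followed by the projection to the first factor `pr` is the identity functor, on the nose
(this is the identity natural transformation `θ_{□⋎} : δ_□ = pr_⋎ ∘ δ_⋎` of Cor 3.7 (ii)).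
[cite: MochizukiAbsTopIII2015, Cor 3.7 (ii) p.88] -/
theorem diagonal_comp_π₁ : diagonal Φ ⋙ CategoricalPullback.π₁ Φ Φ = 𝟭 X := rfl

/-- The component at `A` of a 2-cell `e : F ⋙ Φ ≅ Φ` exhibiting an endofunctor `F` of `𝒳` as
*lying over `𝔈`*, typed as `Φ(F A) ⥲ Φ(A)`. [cite: MochizukiAbsTopIII2015, Cor 3.7 p.86] -/
def overIso (F : X ⥤ X) (e : F ⋙ Φ ≅ Φ) (A : X) : Φ.obj (F.obj A) ≅ Φ.obj A := e.app A

/-- `overIso` unfolds to the component of `e`. [cite: MochizukiAbsTopIII2015, Cor 3.7 p.86] -/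
@[simp]
theorem overIso_hom (F : X ⥤ X) (e : F ⋙ Φ ≅ Φ) (A : X) :
    (overIso Φ F e A).hom = e.hom.app A := rfl

/-- Naturality of the components `overIso`. [cite: MochizukiAbsTopIII2015, Cor 3.7 p.86] -/
@[reassoc]
theorem overIso_hom_naturality (F : X ⥤ X) (e : F ⋙ Φ ≅ Φ) {A B : X} (g : A ⟶ B) :
    Φ.map (F.map g) ≫ (overIso Φ F e B).hom = (overIso Φ F e A).hom ≫ Φ.map g :=
  e.hom.naturality g

/-- Base change `(−) ×_𝔈 𝒳` of an endofunctor `F` of `𝒳` *lying over `𝔈`* via `e : F ⋙ Φ ≅ Φ`: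
the endofunctor `(A₁, A₂, α) ↦ (F A₁, A₂, e_{A₁} ≫ α)` of `𝒳 ×_𝔈 𝒳`. For `F = log_𝒳` this is the
row-1 arrow "`log_𝒳 : 𝒳 ×_𝔈 𝒳 → 𝒳 ×_𝔈 𝒳`" of `𝒟†` ("`𝒟†_{≤1}` is obtained by applying the
categorical fiber product `(−) ×_𝔈 𝒳` to `𝒟_{≤1}`"). [cite: MochizukiAbsTopIII2015, Cor 3.7 p.86] -/
@[simps]
def baseChange (F : X ⥤ X) (e : F ⋙ Φ ≅ Φ) :
    CategoricalPullback Φ Φ ⥤ CategoricalPullback Φ Φ where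
  obj o := ⟨F.obj o.fst, o.snd, overIso Φ F e o.fst ≪≫ o.iso⟩
  map {o o'} f := ⟨F.map f.fst, f.snd, by
    rw [Iso.trans_hom, Iso.trans_hom, Category.assoc, overIso_hom_naturality_assoc,
      CategoricalPullback.Hom.w]⟩
  map_id o := by ext <;> simp
  map_comp f g := by ext <;> simp

/-- Base change acts on the first factor: `(F ×_𝔈 𝒳) ⋙ pr = pr ⋙ F` on the nose.
[cite: MochizukiAbsTopIII2015, Cor 3.7 p.86] -/
theorem baseChange_comp_π₁ (F : X ⥤ X) (e : F ⋙ Φ ≅ Φ) :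
    baseChange Φ F e ⋙ CategoricalPullback.π₁ Φ Φ = CategoricalPullback.π₁ Φ Φ ⋙ F := rfl

/-- Base change does not touch the second factor: `(F ×_𝔈 𝒳) ⋙ π = π` on the nose (this is why
"the second factor `𝒳` forms a core of the functors in `𝒟‡_{≤1}`", Cor 3.7 (i)).
[cite: MochizukiAbsTopIII2015, Cor 3.7 (i) p.87] -/
theorem baseChange_comp_π₂ (F : X ⥤ X) (e : F ⋙ Φ ≅ Φ) :
    baseChange Φ F e ⋙ CategoricalPullback.π₂ Φ Φ = CategoricalPullback.π₂ Φ Φ := rfl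

/-- The structure 2-cell of the fibre square: `pr ⋙ Φ ≅ π ⋙ Φ` (objectwise the `α` of
`(A₁, A₂, α)`); these are the homotopies through which "`𝔈` forms a core of the functors in `𝒟†`"
(Cor 3.7 (i)). [cite: MochizukiAbsTopIII2015, Cor 3.7 (i) p.87] -/
def prCompIsoSndComp :
    CategoricalPullback.π₁ Φ Φ ⋙ Φ ≅ CategoricalPullback.π₂ Φ Φ ⋙ Φ :=
  CatCommSq.iso (CategoricalPullback.π₁ Φ Φ) (CategoricalPullback.π₂ Φ Φ) Φ Φ

/-- The structure 2-cell at `(A₁, A₂, α)` is `α`. [cite: MochizukiAbsTopIII2015, Cor 3.7 (i) p.87] -/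
@[simp]
theorem prCompIsoSndComp_hom_app (o : CategoricalPullback Φ Φ) :
    (prCompIsoSndComp Φ).hom.app o = o.iso.hom := rfl

/-- The *bi-anabelian lift datum* of Cor 3.7 (ii): "`θ^bi : pr^bi_1 ⥲ pr^bi_2` the isomorphism
between the two projection functors `pr^bi_1, pr^bi_2 : 𝒳 ×_𝔈 𝒳 → 𝒳` that arises from the
functoriality — i.e., the bi-anabelian [or 'Grothendieck Conjecture'-type] portion [cf. Remark
1.9.8] — of the 'group-theoretic' algorithms of Corollary 1.10", i.e. every isomorphism
`α : Φ(A₁) ⥲ Φ(A₂)` of arithmetic Galois data lifts, naturally in `(A₁, A₂, α)`, to an isomorphism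
`A₁ ⥲ A₂` of `𝒳` whose image under `Φ` is `α` (`map_θbi`; without this compatibility the datum
would not "arise from" `α`). A hypothesis structure: for the genuine `𝒳 = 𝒞^{MLF-sB}_{T𝔽}` it is
supplied by [AbsTopIII] Cor 1.10 (relative bi-anabelian form), not constructed here.
[cite: MochizukiAbsTopIII2015, Cor 3.7 (ii) p.87] -/
structure BiAnabelianLift where
  /-- `θ^bi : pr^bi_1 ⥲ pr^bi_2`. -/
  θbi : CategoricalPullback.π₁ Φ Φ ≅ CategoricalPullback.π₂ Φ Φ
  /-- `θ^bi` lies over the structure isomorphisms: `Φ(θ^bi_{(A₁,A₂,α)}) = α`. -/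
  map_θbi : ∀ o : CategoricalPullback Φ Φ, Φ.map (θbi.hom.app o) = o.iso.hom

namespace BiAnabelianLift

attribute [simp] map_θbi

variable {Φ} (θ : BiAnabelianLift Φ)

/-- Naturality of `θ^bi` in components: `f₁ ≫ θ^bi_{o'} = θ^bi_o ≫ f₂` for
`(f₁, f₂) : o → o'`. [cite: MochizukiAbsTopIII2015, Cor 3.7 (ii) p.87] -/
@[reassoc]
theorem θbi_naturality {o o' : CategoricalPullback Φ Φ} (f : o ⟶ o') :
    f.fst ≫ θ.θbi.hom.app o' = θ.θbi.hom.app o ≫ f.snd :=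
  θ.θbi.hom.naturality f

/-- `Φ(θ^bi_o⁻¹) = α⁻¹`. [cite: MochizukiAbsTopIII2015, Cor 3.7 (ii) p.87] -/
@[simp]
theorem map_θbi_inv (o : CategoricalPullback Φ Φ) : Φ.map (θ.θbi.inv.app o) = o.iso.inv := by
  have h : Φ.mapIso (θ.θbi.app o) = o.iso := Iso.ext (by simp)
  simpa using congrArg Iso.inv h

/-- Cor 3.7 (ii): "`θ^bi` determines an isomorphism `θ_𝒳 : δ_𝒳 ∘ π_𝒳 ⥲ id_{𝒳 ×_𝔈 𝒳}`" — at
`(A₁, A₂, α)` it is `((θ^bi)⁻¹ : A₂ ⥲ A₁, id_{A₂}) : (A₂, A₂, id) ⥲ (A₁, A₂, α)`, a morphism of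
`𝒳 ×_𝔈 𝒳` precisely because `Φ(θ^bi) = α`. CONSTRUCTED (the printed sentence is discharged for
every bi-anabelian lift datum). [cite: MochizukiAbsTopIII2015, Cor 3.7 (ii) p.87] -/
def thetaX : CategoricalPullback.π₂ Φ Φ ⋙ diagonal Φ ≅ 𝟭 (CategoricalPullback Φ Φ) :=
  NatIso.ofComponents
    (fun o => CategoricalPullback.mkIso (θ.θbi.app o).symm (Iso.refl o.snd) (by
      change Φ.map (θ.θbi.inv.app o) ≫ o.iso.hom = 𝟙 (Φ.obj o.snd) ≫ Φ.map (𝟙 o.snd)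
      rw [map_θbi_inv, Φ.map_id, Category.id_comp]
      exact o.iso.inv_hom_id))
    (fun {o o'} f => CategoricalPullback.hom_ext
      (show f.snd ≫ θ.θbi.inv.app o' = θ.θbi.inv.app o ≫ f.fst from θ.θbi.inv.naturality f)
      (show f.snd ≫ 𝟙 o'.snd = 𝟙 o.snd ≫ f.snd by simp))

/-- First component of `θ_𝒳` at `(A₁, A₂, α)`: `(θ^bi)⁻¹ : A₂ → A₁`.
[cite: MochizukiAbsTopIII2015, Cor 3.7 (ii) p.87] -/
@[simp]
theorem thetaX_hom_app_fst (o : CategoricalPullback Φ Φ) :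
    (θ.thetaX.hom.app o).fst = θ.θbi.inv.app o := rfl

/-- Second component of `θ_𝒳` at `(A₁, A₂, α)`: the identity of `A₂`.
[cite: MochizukiAbsTopIII2015, Cor 3.7 (ii) p.87] -/
@[simp]
theorem thetaX_hom_app_snd (o : CategoricalPullback Φ Φ) :
    (θ.thetaX.hom.app o).snd = 𝟙 o.snd := rfl

/-- Cor 3.7 (ii): "Then `δ_𝒳` is an equivalence of categories, a quasi-inverse for which is given
by the projection to the second factor `π_𝒳 : 𝒳 ×_𝔈 𝒳 → 𝒳`" — the equivalence with functor
`δ_𝒳`, inverse `π_𝒳`, unit the identity (`δ_𝒳 ⋙ π_𝒳 = 𝟭`) and counit `θ_𝒳`. PROVED for every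
bi-anabelian lift datum. [cite: MochizukiAbsTopIII2015, Cor 3.7 (ii) p.87] -/
def diagonalEquivalence : X ≌ CategoricalPullback Φ Φ :=
  CategoryTheory.Equivalence.mk (diagonal Φ) (CategoricalPullback.π₂ Φ Φ) (Iso.refl _) θ.thetaX

/-- The functor of the equivalence is `δ_𝒳`. [cite: MochizukiAbsTopIII2015, Cor 3.7 (ii) p.87] -/
@[simp]
theorem diagonalEquivalence_functor : θ.diagonalEquivalence.functor = diagonal Φ := rfl

/-- The quasi-inverse of the equivalence is `π_𝒳`. [cite: MochizukiAbsTopIII2015, Cor 3.7 (ii) p.87] -/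
@[simp]
theorem diagonalEquivalence_inverse :
    θ.diagonalEquivalence.inverse = CategoricalPullback.π₂ Φ Φ := rfl

include θ in
/-- Hence `δ_𝒳` is an equivalence (Mathlib's `Functor.IsEquivalence`).
[cite: MochizukiAbsTopIII2015, Cor 3.7 (ii) p.87] -/
theorem isEquivalence_diagonal : (diagonal Φ).IsEquivalence :=
  θ.diagonalEquivalence.isEquivalence_functor

include θ in
/-- ... and so is `π_𝒳`. [cite: MochizukiAbsTopIII2015, Cor 3.7 (ii) p.87] -/
theorem isEquivalence_π₂ : (CategoricalPullback.π₂ Φ Φ).IsEquivalence :=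
  θ.diagonalEquivalence.isEquivalence_inverse

end BiAnabelianLift

end FiberSquare

/-! ## The setting of Corollary 3.7: rows ≤ 4 of Cor 3.6's `𝒟`, `T = T𝔽`, as abstract data -/

/-- The INPUT of [AbsTopIII] Cor 3.7 ("in the notation and conventions of Corollary 3.6, suppose,
further, that `T = T𝔽`"): the categories and functors of rows 2–4 of the diagram `𝒟` of Cor 3.6
p. 78 for `T = T𝔽`, abstractly — `X` for `𝒳 = 𝒞^{MLF-sB}_{T𝔽}` (MLF-Galois `T𝔽`-pairs of strictly
Belyi type, Def 3.1 (ii)/(iii) pp. 67–68), `E` for `𝔈 = 𝒯𝔾_{sB}`, `N` for `𝒩 = 𝒞^{MLF-sB}_{T𝕊}`;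
`gal` = the natural functor "`(Π ↷ M) ↦ Π`" `𝒞^{MLF}_T → 𝒯𝔾` (Def 3.1 (iii) p. 68); `log` = the
log-Frobenius functor `log_{T𝔽,T𝔽}` with `logIsoId` = "the functor `log_{T𝔽,T𝔽}` is isomorphic to
the identity functor" (Def 3.1 (iv) p. 69, l. 1 — elementary for `T = T𝔽`; cf. Rmk 3.7.1);
`lamTimes, lamTimesPf` = "`λ^×, λ^{×pf} : 𝒞^{MLF}_{T𝔽} → 𝒞^{MLF}_{T𝕊}`", `iotaLog` =
"`ι_log : λ^× ∘ log_{T𝔽,T𝔽} → λ^{×pf}`", `iotaTimes` = "`ι_× : λ^× → λ^{×pf}`" (Def 3.1 (iv) p. 69);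
`spaceGal` = the arrow `𝒩 → 𝔈` of `𝒟` with `lamTimesGal, lamTimesPfGal` recording that `λ^×`,
`λ^{×pf}` do not change the Galois group (`(Π ↷ k̄) ↦ (Π ↷ k̄^×), (Π ↷ (k̄^×)^pf)`). A hypothesis
structure (plan/FOUNDATIONS.md row 12: the étale-`π₁` instance is a later FACT row) over the three
carrier categories `X` (`𝒳`), `E` (`𝔈`), `N` (`𝒩`).
[cite: MochizukiAbsTopIII2015, Cor 3.7 p.86] -/
structure BiAnabelianSetting (X : Type u₁) [Category.{v₁} X] (E : Type u₂) [Category.{v₂} E]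
    (N : Type u₃) [Category.{v₃} N] where
  /-- `(Π ↷ M) ↦ Π`. -/
  gal : X ⥤ E
  /-- the log-Frobenius functor `log_{T𝔽,T𝔽}`. -/
  log : X ⥤ X
  /-- `log_{T𝔽,T𝔽} ≅ 𝟭` (Def 3.1 (iv)). -/
  logIsoId : log ≅ 𝟭 X
  /-- `λ^×`. -/
  lamTimes : X ⥤ N
  /-- `λ^{×pf}`. -/
  lamTimesPf : X ⥤ N
  /-- `ι_log : λ^× ∘ log → λ^{×pf}`. -/
  iotaLog : log ⋙ lamTimes ⟶ lamTimesPf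
  /-- `ι_× : λ^× → λ^{×pf}`. -/
  iotaTimes : lamTimes ⟶ lamTimesPf
  /-- the arrow `𝒩 → 𝔈` of `𝒟` (`(Π ↷ M) ↦ Π` on `T𝕊`-pairs). -/
  spaceGal : N ⥤ E
  /-- `λ^×` lies over `𝔈`. -/
  lamTimesGal : lamTimes ⋙ spaceGal ≅ gal
  /-- `λ^{×pf}` lies over `𝔈`. -/
  lamTimesPfGal : lamTimesPf ⋙ spaceGal ≅ gal

namespace BiAnabelianSetting

variable {X : Type u₁} [Category.{v₁} X] {E : Type u₂} [Category.{v₂} E] {N : Type u₃}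
  [Category.{v₃} N] (𝔖 : BiAnabelianSetting X E N)

/-- `log` lies over `𝔈` (the Galois group of `(Π ↷ k^~)` is `Π`): the 2-cell `log ⋙ gal ≅ gal`
induced by `logIsoId`. [cite: MochizukiAbsTopIII2015, Def 3.1 (iv) p.68] -/
def logGal : 𝔖.log ⋙ 𝔖.gal ≅ 𝔖.gal :=
  Functor.isoWhiskerRight 𝔖.logIsoId 𝔖.gal ≪≫ 𝔖.gal.leftUnitor

/-- The category `𝒳 ×_𝔈 𝒳` at the row-1 vertices of `𝒟†` (§0 p. 28 categorical fibre product =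
Mathlib `CategoricalPullback`). [cite: MochizukiAbsTopIII2015, Cor 3.7 p.86] -/
abbrev Sq : Type (max u₁ v₂) := CategoricalPullback 𝔖.gal 𝔖.gal

/-- `pr_⋎ : 𝒳 ×_𝔈 𝒳 → 𝒳`, "the projection to the first factor".
[cite: MochizukiAbsTopIII2015, Cor 3.7 p.86] -/
abbrev pr : 𝔖.Sq ⥤ X := CategoricalPullback.π₁ 𝔖.gal 𝔖.gal

/-- `π_⋎ : 𝒳 ×_𝔈 𝒳 → 𝒳`, "the projection to the second factor".
[cite: MochizukiAbsTopIII2015, Cor 3.7 p.87] -/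
abbrev proj : 𝔖.Sq ⥤ X := CategoricalPullback.π₂ 𝔖.gal 𝔖.gal

/-- `log_𝒳 : 𝒳 ×_𝔈 𝒳 → 𝒳 ×_𝔈 𝒳`, the row-1 arrow of `𝒟†` (`= log ×_𝔈 𝒳`).
[cite: MochizukiAbsTopIII2015, Cor 3.7 p.86] -/
abbrev logSq : 𝔖.Sq ⥤ 𝔖.Sq := FiberSquare.baseChange 𝔖.gal 𝔖.log 𝔖.logGal

/-- `δ_𝒳 : 𝒳 → 𝒳 ×_𝔈 𝒳`, the diagonal functor (the telecore edges `δ_⋎` of `𝒟‡_δ`).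
[cite: MochizukiAbsTopIII2015, Cor 3.7 (ii) p.87] -/
abbrev diag : X ⥤ 𝔖.Sq := FiberSquare.diagonal 𝔖.gal

/-- The natural transformation "`ι_{log,⋎} : λ^× ∘ pr_⋎ ∘ log_𝒳 → λ^{×pf} ∘ pr_{⋎+1}`" of Cor 3.7
(iii), as functors `𝒳 ×_𝔈 𝒳 ⥤ 𝒩` out of the vertex `⋎+1` (using `log_𝒳 ⋙ pr = pr ⋙ log` on the
nose): `ι_log` whiskered by `pr`. [cite: MochizukiAbsTopIII2015, Cor 3.7 (iii) p.88] -/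
def iotaLogAt : 𝔖.logSq ⋙ 𝔖.pr ⋙ 𝔖.lamTimes ⟶ 𝔖.pr ⋙ 𝔖.lamTimesPf :=
  Functor.whiskerLeft 𝔖.pr 𝔖.iotaLog

/-- The natural transformation "`ι_× : λ^× → λ^{×pf}`" of Cor 3.7 (iii) seen from a row-1 vertex:
`ι_×` whiskered by `pr`. [cite: MochizukiAbsTopIII2015, Cor 3.7 (iii) p.88] -/
def iotaTimesAt : 𝔖.pr ⋙ 𝔖.lamTimes ⟶ 𝔖.pr ⋙ 𝔖.lamTimesPf :=
  Functor.whiskerLeft 𝔖.pr 𝔖.iotaTimes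

/-- The natural-transformation identity behind the FIRST INCOMPATIBILITY of Cor 3.7 (iv) (read
off the proof of Cor 3.6 (iv) p. 81, to which Cor 3.7's proof p. 88 refers: a core structure of
`𝒟†_{≤2}` on `𝒟†_{≤1}` compatible with `𝔖†_log` yields a homotopy `ζ₀` for the pair of paths
`([pr_{⋎+1}], [pr_⋎] ∘ [log_𝒳])`, and compatibility forces "`ζ'₁ = ζ₁ ∘ ζ'₀`" to "coincide with the
homotopy `ζ₂`", i.e. `λ^×(ζ₀) ≫ ι_log = ι_×`; since `pr ∘ δ_𝒳 = id`, such a `ζ₀` restricts to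
`ζ : 𝟭 ⟶ log`): the kernel statement "there is a natural isomorphism `ζ : 𝟭_𝒳 ⥲ log` with
`λ^×(ζ_A) ≫ ι_{log,A} = ι_{×,A}` for all `A`". Cor 3.7 (iv) says this FAILS for the MLF setting
(via Lemma 3.4); for an abstract setting it is just a `Prop`. Not the printed statement (that is
typed in the sibling file over Def 3.5's formalism) — the auxiliary it reduces to.
[cite: MochizukiAbsTopIII2015, Cor 3.7 (iv) p.88] -/
def LogCoreKernel : Prop :=
  ∃ ζ : 𝟭 X ≅ 𝔖.log, ∀ A : X,
    𝔖.lamTimes.map (ζ.hom.app A) ≫ 𝔖.iotaLog.app A = 𝔖.iotaTimes.app A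

end BiAnabelianSetting

/-! ## The bi-anabelian lift datum is automatically FUNCTORIAL (appended; proofs only) -/

namespace FiberSquare.BiAnabelianLift

variable {X : Type u₁} [Category.{v₁} X] {E : Type u₂} [Category.{v₂} E] {Φ : X ⥤ E}
  (θ : BiAnabelianLift Φ)

/-- "Arises from the functoriality": the lift of a COMPOSITE `α ≫ β` of isomorphisms of Galois data is
the composite of the lifts — a consequence of the naturality of `θ^bi` together with `Φ(θ^bi) = α`
(apply naturality to the morphism `(id, θ^bi_{(A₂,A₃,β)}) : (A₁, A₂, α) → (A₁, A₃, α ≫ β)`).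
[cite: MochizukiAbsTopIII2015, Cor 3.7 (ii) p.87] -/
theorem θbi_app_trans (A₁ A₂ A₃ : X) (α : Φ.obj A₁ ≅ Φ.obj A₂) (β : Φ.obj A₂ ≅ Φ.obj A₃) :
    θ.θbi.hom.app ⟨A₁, A₃, α ≪≫ β⟩ =
      θ.θbi.hom.app ⟨A₁, A₂, α⟩ ≫ θ.θbi.hom.app ⟨A₂, A₃, β⟩ := by
  let m : (⟨A₁, A₂, α⟩ : CategoricalPullback Φ Φ) ⟶ ⟨A₁, A₃, α ≪≫ β⟩ :=
    ⟨𝟙 A₁, θ.θbi.hom.app ⟨A₂, A₃, β⟩, by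
      rw [Functor.map_id, Category.id_comp, Iso.trans_hom]
      exact congrArg (α.hom ≫ ·) (θ.map_θbi ⟨A₂, A₃, β⟩).symm⟩
  exact (Category.id_comp _).symm.trans (θ.θbi.hom.naturality m)

/-- "Arises from the functoriality": the lift of the IDENTITY isomorphism of Galois data is the
identity, i.e. `θ^bi` is trivial on the diagonal `δ_𝒳` (the composition law at `id ≫ id = id` gives
`θ ≫ θ = θ` for the isomorphism `θ = θ^bi_{(A,A,id)}`). [cite: MochizukiAbsTopIII2015, Cor 3.7 (ii) p.87] -/
theorem θbi_app_diagonal (A : X) : θ.θbi.hom.app ((diagonal Φ).obj A) = 𝟙 A := by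
  have h := θ.θbi_app_trans A A A (Iso.refl _) (Iso.refl _)
  rw [Iso.refl_trans] at h
  change θ.θbi.hom.app ⟨A, A, Iso.refl _⟩ = 𝟙 A
  exact (cancel_epi (θ.θbi.hom.app ⟨A, A, Iso.refl _⟩)).mp
    (h.symm.trans (Category.comp_id _).symm)

/-- Hence `θ_𝒳` restricted along `δ_𝒳` is the identity: `θ_𝒳 (δ_𝒳 A) = id`.
[cite: MochizukiAbsTopIII2015, Cor 3.7 (ii) p.87] -/
theorem thetaX_hom_app_diagonal (A : X) : θ.thetaX.hom.app ((diagonal Φ).obj A) = 𝟙 _ := by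
  have e := θ.θbi.inv_hom_id_app ((diagonal Φ).obj A)
  rw [θ.θbi_app_diagonal] at e
  have h1 : θ.θbi.inv.app ((diagonal Φ).obj A) = 𝟙 A := (Category.comp_id _).symm.trans e
  apply CategoricalPullback.hom_ext
  · rw [thetaX_hom_app_fst, CategoricalPullback.id_fst]; exact h1
  · rw [thetaX_hom_app_snd, CategoricalPullback.id_snd]; rfl

end FiberSquare.BiAnabelianLift

end Literature.AnabelianGeometry.AbsoluteAnabelian.AbsTopIII
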